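import Summits.CriticalPhenomena.CardyFormulaZ2.Theorems.CardyComplexConeEdgePrecompactUFRSInitialExitNearStrands
import Summits.CriticalPhenomena.CardyFormulaZ2.Theorems.CardyComplexConeEdgePrecompactUFRSDoublyMarked
import Summits.CriticalPhenomena.CardyFormulaZ2.Theorems.CardyComplexConeEdgePrecompactUFRSResidualsJ

/-!
# The J-form arm domination of UFRS: certificate OR junction, from the two J-form residuals
(line `qkz-strip-boundary-arm` of crux `CardyComplexCone.EdgePrecompact`, stmt-CriticalPhenomena-11387;
item (H₁) `ufrs_armDomination2` of the corrected road map for the uniform forward response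
stability "UFRS": module docstrings of `…UFRSAnnulusCrossings.lean` (correction),
`…UFRSEvents.lean` (vocabulary), `…UFRSResidualsJ.lean` (the junction event))

`ufrs_armDomination2_of_residuals` (`…UFRSArmDomination.lean`) assembles the arm domination —
every forward-response failure at a `2ρ`-deep ball of radius `ρ ≥ 4η`, shift `‖E.δ w‖ < η`, fine
mesh, is certified by `ufrsCert E w z (4η) (ρ/2)` at a collar point `z` — from the failure
analysis of the line and FOUR residual planar sub-goals. Two of them have since been settled in a
weaker form: `ufrs_doublyMarkedCase_cert` is proved (`…UFRSDoublyMarked.lean`), and the INITIAL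
"exit near" configuration is certified by `ufrsCert` OR by the two-scale JUNCTION data at the
start vertex (`ufrs_initialExitNear_junction`, `…UFRSInitialExitNearStrands.lean`) — the junction
event `ufrsJunction E w η ρ` of `…UFRSResidualsJ.lean`, whose probability on rectangles is
controlled by the junction two-strand decay (`ufrs_junctionBranch_le`). This file re-runs the
assembly with the weaker terminal steps: from the J-forms `ufrsResidualSlippedReturnJ`,
`ufrsResidualInitialContactJ` of the two remaining residuals (registered sub-goals
`ufrs_slippedReturnCase_certJ`, `ufrs_initialContactCase_certJ`) it derives the J-FORM ARM
DOMINATION `ufrs_armDominationJ_of_residuals` (registered): every failure is certified by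
`ufrsCert E w z (4η) (ρ/2)` at a collar point OR lies in `ufrsJunction E w η ρ`. The case lemmas
`ufrs_initialCase_certJ_of`, `ufrs_splitCase_certJ_of` are the proofs of `ufrs_initialCase_cert_of`
(`…ArmDominationInitial.lean`) and `ufrs_splitCase_cert_of` (`…ArmDominationSplit.lean`) verbatim,
with the junction alternative carried along; the glue `ufrs_of_piecesJ` (`…UFRSPiecesJ.lean`) feeds
the J-form domination into `ufrs_of_screenedArmDomination` with `B := ufrsJunction`.

References: S. Smirnov, C. R. Acad. Sci. Paris 333 (2001), §2; G. F. Lawler, O. Schramm,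
W. Werner, Electron. J. Probab. 7 (2002), App. A; P. Nolin, Electron. J. Probab. 13 (2008), §4;
H. Hopf, Compositio Math. 2 (1935).
-/

namespace Summit.CriticalPhenomena.CardyFormulaZ2.Cruxes.EdgePrecompact.QkzStripBoundaryArm

open MeasureTheory Filter Set Metric
open scoped Topology BigOperators Pointwise
open Literature.Probability.LatticeModels Literature.Probability.Percolation
open Literature.Probability.RandomPlanarGeometry (DobrushinDomain)
open Summit.CriticalPhenomena.CardyFormulaZ2.Theses.CardyComplexCone

noncomputable section

/-- The conclusion of a J-form residual at a datum `E` of `D` (`E.Ω = D.carrier`) — at a collar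
point, the certificate or the two-scale junction data — gives "certificate at a collar point, or
`ω ∈ ufrsJunction E w η ρ`". -/
theorem certOrJunction_of_J {D : DobrushinDomain} {E : DiscreteDobrushin} {w : Site 2} {η ρ : ℝ} {ω : BondConfig (Site 2)} (hEΩ : E.Ω = D.carrier) :
    (∃ z ∈ D.carrier, infDist z D.carrierᶜ < 3 * η ∧ (ω ∈ ufrsCert E w z (4 * η) (ρ / 2) ∨ (z ∈ ufrsMarkedNbhd E w (4 * η) ∧ ∃ R' : ℝ, (∃ k : ℕ, R' = ρ / 2 / 2 / 2 ^ (k + 1)) ∧ 32 * (4 * η) ≤ R' ∧ ω ∈ ufrsStrands E w z 2 (4 * η) R' ∧ ω ∈ ufrsStrands E w z 2 (4 * R') (ρ / 2 / 2)))) →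
    (∃ z ∈ D.carrier, infDist z D.carrierᶜ < 3 * η ∧ ω ∈ ufrsCert E w z (4 * η) (ρ / 2)) ∨ ω ∈ ufrsJunction E w η ρ := by
  rintro ⟨z, hzD, hzc, hcert | ⟨hmk, R', hR', h32, h₁, h₂⟩⟩
  · exact Or.inl ⟨z, hzD, hzc, hcert⟩
  · refine Or.inr ⟨z, ?_, ?_, hmk, R', hR', h32, h₁, h₂⟩
    · rw [hEΩ]; exact hzD
    · rw [hEΩ]; exact hzc

/-- **The INITIAL case, J-form**: the statement of `ufrs_initialCase_cert_of`
(`…ArmDominationInitial.lean`) with the residual `ufrs_initialContactCase_cert` replaced by its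
J-form `ufrsResidualInitialContactJ`, the residual `ufrs_initialExitNearCase_cert` replaced by the
proved `ufrs_initialExitNear_junction`, and the conclusion weakened to "certificate at a collar
point OR `ω ∈ ufrsJunction E w η ρ`". Proof: verbatim that of `ufrs_initialCase_cert_of` — by
`ufrs_initialStrands`; with disjoint start strands and the second strand reaching the ball, or the
exit corner of the translate at distance `≥ ρ/4`, the NEAR branch holds at the start vertex; the
other two configurations are the J-form residual and the junction lemma. -/
theorem ufrs_initialCase_certJ_of : ufrsResidualInitialContactJ → ∀ (D : DobrushinDomain) (η : ℝ), 0 < η → ∃ δ₀ > (0:ℝ), ∀ E : DiscreteDobrushin, E.Ω = D.carrier → E.IsZdAdmissible → E.δ < δ₀ → ∀ (v w : Site 2) (ρ : ℝ), 4 * η ≤ ρ → 2 * ρ ≤ infDist (meshPoint E.δ v) D.carrierᶜ → ‖meshPoint E.δ w‖ < η → ∀ (ω : BondConfig (Site 2)) (a a' : Site 2 × Fin 4) (n : ℕ), E.IsStartCorner a → (shiftData E w).IsStartCorner a' → (∀ i < n, medialPoint E.δ (cTgt (cornerOrbit (E.bcBondConfig ω) a i)) ∉ ball (meshPoint E.δ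 v) ρ ∧ E.IsInnerFace (cFace (cornerOrbit (E.bcBondConfig ω) a (i + 1)))) → medialPoint E.δ (cTgt (cornerOrbit (E.bcBondConfig ω) a n)) ∈ ball (meshPoint E.δ v) ρ → (∀ m k : ℕ, m ≤ n → (∀ i < k, medialPoint E.δ (cTgt (cornerOrbit ((shiftData E w).bcBondConfig ω) a' i)) ∉ ball (meshPoint E.δ v) ρ ∧ (shiftData E w).IsInnerFace (cFace (cornerOrbit ((shiftData E w).bcBondConfig ω) a' (i + 1)))) → cornerOrbit ((shiftData E w).bcBondConfig ω) a' k = cornerOrbit (E.bcBondConfig ω) a m → ∑ i ∈ Finset.range k, turnOf ((shiftData E w).bcBondConfig ω) (cornerOrbit ((shiftData E w).bcBondConfig ω) a' i) ≠ ∑ i ∈ Finset.range m, turnOf (E.bcBondConfig ω) (cornerOrbit (E.bcBondConfig ω) a i)) → (∃ z ∈ D.carrier, infDist z D.carrierᶜ < 3 * η ∧ ω ∈ ufrsCert E w z (4 * η) (ρ / 2)) ∨ ω ∈ ufrsJunction E w η ρ := by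
  intro hC D η hη
  obtain ⟨δ₁, hδ₁, hinitS⟩ := ufrs_initialStrands D η hη
  obtain ⟨δ₂, hδ₂, hcollar⟩ := collarAgreement D η hη
  obtain ⟨δ₃, hδ₃, hc⟩ := ufrsResidualInitialContactJ_iff.1 hC D η hη
  obtain ⟨δ₄, hδ₄, hx⟩ := ufrs_initialExitNear_junction D η hη
  refine ⟨min (min δ₁ δ₂) (min (min δ₃ δ₄) η), lt_min (lt_min hδ₁ hδ₂) (lt_min (lt_min hδ₃ hδ₄) hη), ?_⟩
  intro E hEΩ hE hEδ v w ρ hηρ hv hw ω a a' n ha ha' hStr hball hinit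
  have hδ : 0 < E.δ := hE.delta_pos
  have hδ₁' : E.δ < δ₁ := lt_of_lt_of_le hEδ ((min_le_left _ _).trans (min_le_left _ _))
  have hδ₂' : E.δ < δ₂ := lt_of_lt_of_le hEδ ((min_le_left _ _).trans (min_le_right _ _))
  have hδ₃' : E.δ < δ₃ := lt_of_lt_of_le hEδ ((min_le_right _ _).trans ((min_le_left _ _).trans (min_le_left _ _)))
  have hδ₄' : E.δ < δ₄ := lt_of_lt_of_le hEδ ((min_le_right _ _).trans ((min_le_left _ _).trans (min_le_right _ _)))
  have hδη : E.δ ≤ η := (lt_of_lt_of_le hEδ ((min_le_right _ _).trans (min_le_right _ _))).le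
  obtain ⟨ha'eq, T, hrun, hend, hsimple, hrsimple, hcontact⟩ :=
    hinitS E hEΩ hE hδ₁' v w ρ hw ω a a' n ha ha' hStr hball hinit
  rcases hcontact with hdisj | ⟨j, i, ℓ, hjT, hin, hEq, hfirst, hℓ, hsumℓ, -⟩
  swap
  · -- a first contact with a turning offset: J-form residual sub-goal
    exact certOrJunction_of_J hEΩ
      (hc E hEΩ hE hδ₃' v w ρ hηρ hv hw ω a a' n T j i ℓ ha ha' hStr hball hinit hrun hend hjT hin hEq hfirst hℓ hsumℓ)
  -- the two start strands share no corner
  have hinner : ∀ x : Site 2, 3 * η ≤ infDist (meshPoint E.δ x) D.carrierᶜ → ∀ f : Site 2,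
      IsCorner x f → E.IsInnerFace f ∧ (shiftData E w).IsInnerFace f := fun x hx =>
    (hcollar E hEΩ hE hδ₂' w hw ω x hx x (by rw [dist_self]; positivity)).2
  -- the start vertex is a collar point of `D`
  have hcol : infDist (meshPoint E.δ a.1) D.carrierᶜ < 3 * η := by
    by_contra hdeep
    rw [not_lt] at hdeep
    exact ha.isOutEdge.2 (hinner a.1 hdeep _ (isCorner_faceAt _ _)).1
  have hzD : (meshPoint E.δ a.1) ∈ D.carrier := by
    rw [← hEΩ]
    exact (ufrs_discrepancyEdges E w ω).2.2 a ha.isOutEdge.1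
  have hZ : ω ∈ ufrsCert E w (meshPoint E.δ a.1) (4 * η) (ρ / 2) → (∃ z ∈ D.carrier, infDist z D.carrierᶜ < 3 * η ∧ ω ∈ ufrsCert E w z (4 * η) (ρ / 2)) ∨ ω ∈ ufrsJunction E w η ρ :=
    fun hcert => Or.inl ⟨_, hzD, hcol, hcert⟩
  -- the first start strand `O₀ a [0, n]` is long
  have hfar₀ : ρ - 3 * η - 2 * E.δ - 0 < dist (meshPoint E.δ (cornerOrbit (E.bcBondConfig ω) a n).1) (meshPoint E.δ a.1) :=
    far_of_near_cTgt_mem_ball_W3H hδ.le hv hcol (by rw [dist_self]) hball (by rw [dist_self]; exact hδ.le)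
  have hface₀ : ∀ t ≤ n, E.IsInnerFace (cFace (cornerOrbit (E.bcBondConfig ω) a t)) := by
    intro t ht
    rcases Nat.eq_zero_or_pos t with rfl | hpos
    · exact ha.isOutEdge.1
    · obtain ⟨t', rfl⟩ : ∃ t', t = t' + 1 := ⟨t - 1, by omega⟩
      exact (hStr t' (by omega)).2
  have hface₁ : ∀ t ≤ T, (shiftData E w).IsInnerFace (cFace (cornerOrbit ((shiftData E w).bcBondConfig ω) a' t)) := by
    intro t ht
    rcases Nat.eq_zero_or_pos t with rfl | hpos
    · exact ha'.isOutEdge.1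
    · obtain ⟨t', rfl⟩ : ∃ t', t = t' + 1 := ⟨t - 1, by omega⟩
      exact (hrun t' (by omega)).2
  have hnear₁ : dist (meshPoint E.δ (cornerOrbit ((shiftData E w).bcBondConfig ω) a' 0).1) (meshPoint E.δ a.1) ≤ 128 * (4 * η) := by
    have h1 : (cornerOrbit ((shiftData E w).bcBondConfig ω) a' 0).1 = a.1 + w := by
      show a'.1 = a.1 + w
      rw [ha'eq]
    rw [h1, meshPoint_add_shift, dist_eq_norm, add_sub_cancel_right]
    linarith [hw.le]
  -- certificate from a long second start strand
  have key : (256 * (4 * η) ≤ ρ / 2 → ρ / 2 / 2 ≤ dist (meshPoint E.δ (cornerOrbit ((shiftData E w).bcBondConfig ω) a' T).1) (meshPoint E.δ a.1)) →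
      ω ∈ ufrsCert E w (meshPoint E.δ a.1) (4 * η) (ρ / 2) := by
    intro hfar₁'
    by_cases hesc : ρ / 2 < 256 * (4 * η)
    · exact mem_ufrsCert_of_lt_W3H hesc
    rw [not_lt] at hesc
    have hfar₁ := hfar₁' hesc
    have hσ₁ : 0 ≤ n ∧ ((dist (meshPoint E.δ (cornerOrbit (E.bcBondConfig ω) a 0).1) (meshPoint E.δ a.1) ≤ (128 * (4 * η)) ∧ (ρ / 2 / 2) ≤ dist (meshPoint E.δ (cornerOrbit (E.bcBondConfig ω) a n).1) (meshPoint E.δ a.1)) ∨ ((ρ / 2 / 2) ≤ dist (meshPoint E.δ (cornerOrbit (E.bcBondConfig ω) a 0).1) (meshPoint E.δ a.1) ∧ dist (meshPoint E.δ (cornerOrbit (E.bcBondConfig ω) a n).1) (meshPoint E.δ a.1) ≤ (128 * (4 * η)))) ∧ (∀ t, 0 ≤ t → t ≤ n → E.IsInnerFace (cFace (cornerOrbit (E.bcBondConfig ω) a t))) ∧ (∀ s t, 0 ≤ s → s < t → t ≤ n → cornerOrbit (E.bcBondConfig ω) a s ≠ cornerOrbit (E.bcBondConfig ω) a t) :=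 by
      refine ⟨Nat.zero_le _, Or.inl ⟨?_, by linarith⟩, fun t _ ht => hface₀ t ht, stretch_ne_of_lt_W3H hsimple le_rfl⟩
      show dist (meshPoint E.δ a.1) (meshPoint E.δ a.1) ≤ _
      rw [dist_self]; positivity
    have hσ₂ : 0 ≤ T ∧ ((dist (meshPoint E.δ (cornerOrbit ((shiftData E w).bcBondConfig ω) a' 0).1) (meshPoint E.δ a.1) ≤ (128 * (4 * η)) ∧ (ρ / 2 / 2) ≤ dist (meshPoint E.δ (cornerOrbit ((shiftData E w).bcBondConfig ω) a' T).1) (meshPoint E.δ a.1)) ∨ ((ρ / 2 / 2) ≤ dist (meshPoint E.δ (cornerOrbit ((shiftData E w).bcBondConfig ω) a' 0).1) (meshPoint E.δ a.1) ∧ dist (meshPoint E.δ (cornerOrbit ((shiftData E w).bcBondConfig ω) a' T).1) (meshPoint E.δ a.1) ≤ (128 * (4 * η)))) ∧ (∀ t, 0 ≤ t → t ≤ T → (shiftData E w).IsInnerFace (cFace (cornerOrbit ((shiftData E w).bcBondConfig ω) a' t))) ∧ (∀ s t, 0 ≤ s → s < t → t ≤ T → cornerOrbit ((shiftData E w).bcBondConfig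 ω) a' s ≠ cornerOrbit ((shiftData E w).bcBondConfig ω) a' t) :=
      ⟨Nat.zero_le _, Or.inl ⟨hnear₁, hfar₁⟩, fun t _ ht => hface₁ t ht, stretch_ne_of_lt_W3H hrsimple le_rfl⟩
    have hd : ∀ s t, 0 ≤ s → s ≤ n → 0 ≤ t → t ≤ T → cornerOrbit (E.bcBondConfig ω) a s ≠ cornerOrbit ((shiftData E w).bcBondConfig ω) a' t :=
      fun s t _ hs _ ht h => hdisj t ht s hs h.symm
    apply mem_ufrsCert_of_near_W3H
    apply mem_ufrsCertNear_of_strands_W3H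
    · rw [mem_ufrsMarkedNbhd_iff]
      refine ⟨cSrc a, Or.inl (DiscreteDobrushin.cSrc_mem_zdABEdges ha.mem_zdArcA ha.mem_zdArcB (Or.inl ha.isOutEdge)), ?_⟩
      have := dist_medialPoint_cSrc_le' hδ.le a
      linarith
    · exact mem_ufrsStrands_two_W3H true false a a' 0 n 0 T hσ₁ hσ₂ hd
  rcases hend with hballT | hout
  · -- the second start strand reaches the ball
    refine hZ (key fun hesc => ?_)
    have := far_of_near_cTgt_mem_ball_W3H hδ.le hv hcol (z := (meshPoint E.δ a.1)) (s := 0) (by rw [dist_self]) hballT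
      (by rw [dist_self]; exact hδ.le)
    linarith
  · -- the second start strand leaves the inner faces of the translate at its exit corner
    by_cases hDF : ρ / 2 / 2 ≤ dist (meshPoint E.δ (cornerOrbit ((shiftData E w).bcBondConfig ω) a' T).1) (meshPoint E.δ a.1)
    · exact hZ (key fun _ => hDF)
    · rw [not_le] at hDF
      exact certOrJunction_of_J hEΩ
        (hx E hEΩ hE hδ₄' v w ρ hηρ hv hw ω a a' n T ha ha' hStr hball hinit hrun hout hdisj hDF)

/-- **The SPLIT branch, J-form**: the statement of `ufrs_splitCase_cert_of`
(`…ArmDominationSplit.lean`) with the residual `ufrs_slippedReturnCase_cert` replaced by its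
J-form `ufrsResidualSlippedReturnJ`, the residual `ufrs_doublyMarkedCase_cert` discharged by its
proof (`…UFRSDoublyMarked.lean`), and the conclusion weakened to "certificate at a collar point OR
`ω ∈ ufrsJunction E w η ρ`". Proof: verbatim that of `ufrs_splitCase_cert_of` — by
`ufrs_lastDeparture`, a nonempty free tail (`ufrs_freeTailCase_cert_of`), or the run ends on the
stretch: entering the ball at the re-entry corner (the J-form residual), or leaving the inner faces
of the translate at its exit corner (`ufrs_exitCornerOnStretch_cert`). -/
theorem ufrs_splitCase_certJ_of : ufrsResidualSlippedReturnJ → ∀ (D : DobrushinDomain) (η : ℝ), 0 < η → ∃ δ₀ > (0:ℝ), ∀ E : DiscreteDobrushin, E.Ω = D.carrier → E.IsZdAdmissible → E.δ < δ₀ → ∀ (v w : Site 2) (ρ : ℝ), 4 * η ≤ ρ → 2 * ρ ≤ infDist (meshPoint E.δ v) D.carrierᶜ → ‖meshPoint E.δ w‖ < η → ∀ (ω : BondConfig (Site 2)) (a a' : Site 2 × Fin 4) (n m k T : ℕ), ((E.IsStartCorner a ∧ (shiftData E w).IsStartCorner a') ∨ (a = a' ∧ medialPoint E.δ (cSrc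 a) ∈ ball (meshPoint E.δ v) ρ ∧ medialPoint E.δ (cTgt a) ∉ ball (meshPoint E.δ v) ρ)) → (∀ i < n, medialPoint E.δ (cTgt (cornerOrbit (E.bcBondConfig ω) a i)) ∉ ball (meshPoint E.δ v) ρ ∧ E.IsInnerFace (cFace (cornerOrbit (E.bcBondConfig ω) a (i + 1)))) → medialPoint E.δ (cTgt (cornerOrbit (E.bcBondConfig ω) a n)) ∈ ball (meshPoint E.δ v) ρ → m < n → (∀ i < k, medialPoint E.δ (cTgt (cornerOrbit ((shiftData E w).bcBondConfig ω) a' i)) ∉ ball (meshPoint E.δ v) ρ ∧ (shiftData E w).IsInnerFace (cFace (cornerOrbit ((shiftData E w).bcBondConfig ω) a' (i + 1)))) → cornerOrbit ((shiftData E w).bcBondConfig ω) a' k = cornerOrbit (E.bcBondConfig ω) a m → ∑ i ∈ Finset.range k, turnOf ((shiftData E w).bcBondConfig ω) (cornerOrbit ((shiftData E w).bcBondConfig ω) a' i) = ∑ i ∈ Finset.range m, turnOf (E.bcBondConfig ω) (cornerOrbit (E.bcBondConfig ω) a i) → infDist (meshPoint E.δ (cornerOrbit (E.bcBondConfig ω)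 a m).1) D.carrierᶜ < 3 * η → ¬ (cTgt (cornerOrbit (E.bcBondConfig ω) a m) ∈ E.bcBondConfig ω ↔ cTgt (cornerOrbit (E.bcBondConfig ω) a m) ∈ (shiftData E w).bcBondConfig ω) → (∀ j j₀ : ℕ, m < j₀ → j₀ ≤ n → (∀ i < j, medialPoint E.δ (cTgt (cornerOrbit ((shiftData E w).bcBondConfig ω) (cornerOrbit (E.bcBondConfig ω) a m) i)) ∉ ball (meshPoint E.δ v) ρ ∧ (shiftData E w).IsInnerFace (cFace (cornerOrbit ((shiftData E w).bcBondConfig ω) (cornerOrbit (E.bcBondConfig ω) a m) (i + 1)))) → cornerOrbit ((shiftData E w).bcBondConfig ω) (cornerOrbit (E.bcBondConfig ω) a m) j = cornerOrbit (E.bcBondConfig ω) a j₀ → ∑ i ∈ Finset.range j, turnOf ((shiftData E w).bcBondConfig ω) (cornerOrbit ((shiftData E w).bcBondConfig ω) (cornerOrbit (E.bcBondConfig ω) a m) i) ≠ ∑ i ∈ Finset.Ico m j₀, turnOf (E.bcBondConfig ω) (cornerOrbit (E.bcBondConfig ω) a i)) → (∀ i < T, medialPoint E.δ (cTgt (cornerOrbit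 ((shiftData E w).bcBondConfig ω) (cornerOrbit (E.bcBondConfig ω) a m) i)) ∉ ball (meshPoint E.δ v) ρ ∧ (shiftData E w).IsInnerFace (cFace (cornerOrbit ((shiftData E w).bcBondConfig ω) (cornerOrbit (E.bcBondConfig ω) a m) (i + 1)))) → (medialPoint E.δ (cTgt (cornerOrbit ((shiftData E w).bcBondConfig ω) (cornerOrbit (E.bcBondConfig ω) a m) T)) ∈ ball (meshPoint E.δ v) ρ ∨ ¬ (shiftData E w).IsInnerFace (cFace (cornerOrbit ((shiftData E w).bcBondConfig ω) (cornerOrbit (E.bcBondConfig ω) a m) (T + 1)))) → (∃ z ∈ D.carrier, infDist z D.carrierᶜ < 3 * η ∧ ω ∈ ufrsCert E w z (4 * η) (ρ / 2)) ∨ ω ∈ ufrsJunction E w η ρ := by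
  intro hRS D η hη
  obtain ⟨δ₁, hδ₁, hlast⟩ := ufrs_lastDeparture D η hη
  obtain ⟨δ₂, hδ₂, hrs⟩ := ufrsResidualSlippedReturnJ_iff.1 hRS D η hη
  obtain ⟨δ₃, hδ₃, hft⟩ :=
    ufrs_freeTailCase_cert_of (ufrsResidualDoublyMarked_iff.2 ufrs_doublyMarkedCase_cert) D η hη
  obtain ⟨δ₄, hδ₄, hex⟩ := ufrs_exitCornerOnStretch_cert D η hη
  refine ⟨min (min δ₁ δ₂) (min δ₃ δ₄), lt_min (lt_min hδ₁ hδ₂) (lt_min hδ₃ hδ₄), ?_⟩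
  intro E hEΩ hE hEδ v w ρ hηρ hv hw ω a a' n m k T hpair hStr hball hmn hStr₁ hek hsum hcolm hniff hmis hrun hend
  have hδ₁' : E.δ < δ₁ := lt_of_lt_of_le hEδ ((min_le_left _ _).trans (min_le_left _ _))
  have hδ₂' : E.δ < δ₂ := lt_of_lt_of_le hEδ ((min_le_left _ _).trans (min_le_right _ _))
  have hδ₃' : E.δ < δ₃ := lt_of_lt_of_le hEδ ((min_le_right _ _).trans (min_le_left _ _))
  have hδ₄' : E.δ < δ₄ := lt_of_lt_of_le hEδ ((min_le_right _ _).trans (min_le_right _ _))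
  obtain ⟨j, i, hjT, hin, hEq, -, hfree, -, -, hTcase⟩ :=
    hlast E hEΩ hE hδ₁' v w ρ hηρ hv hw ω a a' n m k T hpair hStr hball hmn.le hStr₁ hek hrun hend
  rcases Nat.lt_or_ge j T with hjlt | hjge
  · -- nonempty free tail
    exact Or.inl (hft E hEΩ hE hδ₃' v w ρ hηρ hv hw ω a a' n m k T j i hpair hStr hball hmn hStr₁ hek hsum hcolm hniff
      hmis hrun hend hjlt hin hEq hfree)
  · have hjE : j = T := le_antisymm hjT hjge
    rcases hTcase hjE with ⟨hballT, hieq⟩ | ⟨-, -, hA, hB, hIn, -, -, hcolζ⟩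
    · -- slipped return: the run ends at the re-entry corner (J-form residual sub-goal)
      refine certOrJunction_of_J hEΩ (hrs E hEΩ hE hδ₂' v w ρ hηρ hv hw ω a a' n m k T hpair hStr hball hmn hStr₁ hek
        hsum hcolm hniff hmis hrun hend ?_ hballT)
      rw [← hjE, hEq, hieq]
    · -- the run leaves the inner faces of the translate at its exit corner, on the stretch
      exact Or.inl (hex E hEΩ hE hδ₄' v w ρ hηρ hv hw ω a a' n i hpair hStr hball hin hA hB hIn hcolζ)

/-- **The J-form arm domination from the two J-form residuals** (registered sub-goal
`ufrs_armDominationJ_of_residuals` of stmt-CriticalPhenomena-11387). HYPOTHESES: the named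
propositions `ufrsResidualSlippedReturnJ`, `ufrsResidualInitialContactJ` of `…UFRSResidualsJ.lean`
(verbatim the registered residual sub-goals `ufrs_slippedReturnCase_certJ`,
`ufrs_initialContactCase_certJ`). CONCLUSION: for `η > 0` a mesh threshold, below which every
forward-response failure at a `2ρ`-deep ball of radius `ρ ≥ 4η`, shift `‖E.δ w‖ < η`, is certified
by `ufrsCert E w z (4η) (ρ/2)` at a collar point `z ∈ D`, OR lies in the junction event
`ufrsJunction E w η ρ` — hypothesis (H₁) of `ufrs_of_screenedArmDomination` with `A := ufrsCert`,
`B := ufrsJunction`. Proof: that of `ufrs_armDomination2_of_residuals` — `ufrs_failureStructure`,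
then `ufrs_initialCase_certJ_of`, `ufrs_faceCase_cert`, `ufrs_splitCase_certJ_of`. -/
theorem ufrs_armDominationJ_of_residuals : ufrsResidualSlippedReturnJ → ufrsResidualInitialContactJ → ∀ (D : DobrushinDomain) (η : ℝ), 0 < η → ∃ δ₀ > (0:ℝ), ∀ E : DiscreteDobrushin, E.Ω = D.carrier → E.IsZdAdmissible → E.δ < δ₀ → ∀ (v w : Site 2) (ρ : ℝ), 4 * η ≤ ρ → 2 * ρ ≤ infDist (meshPoint E.δ v) D.carrierᶜ → ‖meshPoint E.δ w‖ < η → ∀ ω : BondConfig (Site 2), (¬ ∀ a a' : Site 2 × Fin 4, ((E.IsStartCorner a ∧ (shiftData E w).IsStartCorner a') ∨ (a = a' ∧ medialPoint E.δ (cSrc a) ∈ ball (meshPoint E.δ v) ρ ∧ medialPoint E.δ (cTgt a) ∉ ball (meshPoint E.δ v) ρ)) → ∀ n : ℕ, (∀ i < n, medialPoint E.δ (cTgt (cornerOrbit (E.bcBondConfig ω) a i)) ∉ ball (meshPoint E.δ v) ρ ∧ E.IsInnerFace (cFace (cornerOrbit (E.bcBondConfig ω) a (i + 1)))) → medialPoint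 E.δ (cTgt (cornerOrbit (E.bcBondConfig ω) a n)) ∈ ball (meshPoint E.δ v) ρ → ∃ n' : ℕ, (∀ i < n', medialPoint E.δ (cTgt (cornerOrbit ((shiftData E w).bcBondConfig ω) a' i)) ∉ ball (meshPoint E.δ v) ρ ∧ (shiftData E w).IsInnerFace (cFace (cornerOrbit ((shiftData E w).bcBondConfig ω) a' (i + 1)))) ∧ cornerOrbit ((shiftData E w).bcBondConfig ω) a' n' = cornerOrbit (E.bcBondConfig ω) a n ∧ ∑ i ∈ Finset.range n', turnOf ((shiftData E w).bcBondConfig ω) (cornerOrbit ((shiftData E w).bcBondConfig ω) a' i) = ∑ i ∈ Finset.range n, turnOf (E.bcBondConfig ω) (cornerOrbit (E.bcBondConfig ω) a i)) → (∃ z ∈ D.carrier, infDist z D.carrierᶜ < 3 * η ∧ ω ∈ ufrsCert E w z (4 * η) (ρ / 2)) ∨ ω ∈ ufrsJunction E w η ρ := by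
  intro hRS hIC D η hη
  obtain ⟨δ₁, hδ₁, hfs⟩ := ufrs_failureStructure D η hη
  obtain ⟨δ₂, hδ₂, hface⟩ := ufrs_faceCase_cert D η hη
  obtain ⟨δ₃, hδ₃, hsplit⟩ := ufrs_splitCase_certJ_of hRS D η hη
  obtain ⟨δ₄, hδ₄, hinit⟩ := ufrs_initialCase_certJ_of hIC D η hη
  refine ⟨min (min δ₁ δ₂) (min δ₃ δ₄), lt_min (lt_min hδ₁ hδ₂) (lt_min hδ₃ hδ₄), ?_⟩
  intro E hEΩ hE hEδ v w ρ hηρ hv hw ω hfail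
  have hδ₁' : E.δ < δ₁ := lt_of_lt_of_le hEδ ((min_le_left _ _).trans (min_le_left _ _))
  have hδ₂' : E.δ < δ₂ := lt_of_lt_of_le hEδ ((min_le_left _ _).trans (min_le_right _ _))
  have hδ₃' : E.δ < δ₃ := lt_of_lt_of_le hEδ ((min_le_right _ _).trans (min_le_left _ _))
  have hδ₄' : E.δ < δ₄ := lt_of_lt_of_le hEδ ((min_le_right _ _).trans (min_le_right _ _))
  -- the failing pair
  obtain ⟨a, a', hpair, hnot⟩ : ∃ a a' : Site 2 × Fin 4, ((E.IsStartCorner a ∧ (shiftData E w).IsStartCorner a') ∨ (a = a' ∧ medialPoint E.δ (cSrc a) ∈ ball (meshPoint E.δ v) ρ ∧ medialPoint E.δ (cTgt a) ∉ ball (meshPoint E.δ v) ρ)) ∧ ¬ ∀ n : ℕ, (∀ i < n, medialPoint E.δ (cTgt (cornerOrbit (E.bcBondConfig ω) a i)) ∉ ball (meshPoint E.δ v) ρ ∧ E.IsInnerFace (cFace (cornerOrbit (E.bcBondConfig ω) a (i + 1)))) → medialPoint E.δ (cTgt (cornerOrbit (E.bcBondConfig ω) a n)) ∈ ball (meshPoint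 E.δ v) ρ → ∃ n' : ℕ, (∀ i < n', medialPoint E.δ (cTgt (cornerOrbit ((shiftData E w).bcBondConfig ω) a' i)) ∉ ball (meshPoint E.δ v) ρ ∧ (shiftData E w).IsInnerFace (cFace (cornerOrbit ((shiftData E w).bcBondConfig ω) a' (i + 1)))) ∧ cornerOrbit ((shiftData E w).bcBondConfig ω) a' n' = cornerOrbit (E.bcBondConfig ω) a n ∧ ∑ i ∈ Finset.range n', turnOf ((shiftData E w).bcBondConfig ω) (cornerOrbit ((shiftData E w).bcBondConfig ω) a' i) = ∑ i ∈ Finset.range n, turnOf (E.bcBondConfig ω) (cornerOrbit (E.bcBondConfig ω) a i) := by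
    by_contra h
    apply hfail
    intro a a' hpair
    by_contra h'
    exact h ⟨a, a', hpair, h'⟩
  obtain ⟨n, hStr, hball, hcases⟩ := hfs E hEΩ hE hδ₁' v w ρ hηρ hv hw ω a a' (shiftData E w) (E.bcBondConfig ω)
    ((shiftData E w).bcBondConfig ω) {e | medialPoint E.δ e ∈ ball (meshPoint E.δ v) ρ} rfl rfl rfl rfl hpair hnot
  rcases hcases with ⟨ha, ha', hini⟩ | ⟨m, k, hmn, hStr₁, hek, hsum, hcol, hFS⟩
  · exact hinit E hEΩ hE hδ₄' v w ρ hηρ hv hw ω a a' n ha ha' hStr hball hini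
  · rcases hFS with ⟨hiff, hstep, -, hnot₁⟩ | ⟨hniff, hmis, T, hrun, hend⟩
    · exact Or.inl (hface E hEΩ hE hδ₂' v w ρ hηρ hv hw ω a a' n m k hpair hStr hball hmn (fun i hi => (hStr₁ i hi).2)
        hek hiff hstep hnot₁)
    · exact hsplit E hEΩ hE hδ₃' v w ρ hηρ hv hw ω a a' n m k T hpair hStr hball hmn hStr₁ hek hsum hcol hniff hmis
        hrun hend

end

end Summit.CriticalPhenomena.CardyFormulaZ2.Cruxes.EdgePrecompact.QkzStripBoundaryArm
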